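import Summits.ABC.IUTFork.Repair.RHHeightScalingR4Classes
import HarnessLib

/-!
# R-H ROUND 4, row R4OBJ-FACES — THE TYPED CLASS PROPS DECIDED ON THE KERNEL (part 1): the generic RAY FACE («linear mass + height-free price
# ceiling ⇒ `Ray_NegExponent`»; «linear mass + linear price floor ⇒ `Ray_Door`») and the classes (iii) TOWER and (iv) ARCH:
# `Tower_NegExponent`, `¬ Tower_Door`, `Arch_SharpeningNegExponent`, `Arch_InflationDoor` — PROVED (PROOF-ONLY, 0 definitions)

abc-iut cell, rung LADDER-ABC:A2.RESCUE.H, ROUND 4 (HUMAN D-0133 · D-0134 · D-0135; KEY `wake/KEY-abc-iut-rh2-w-2-R4OBJ-FACES.md`, abc-iut-rh-lead g5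
2026-08-27T13:46:57Z «for each R4-6 class as its exponent is decided: `theorem ClassX_negExponent : ClassX_NegExponent` … or the door witness theorem»;
referee rh-ref-2). Seat abc-iut-rh2-w-2. THE PROPS are abc-iut-rh2-T-1's (R4OBJ-TYPE) `Repair/RHHeightScalingR4Classes.lean` (p538051 + p538930):
`PlaceRay`, `totalDemand`, `totalPrice`, `nettingKept`, `stepProfile`, `Ray_NegExponent`, `Ray_Door`, `towerRay`, `archRay`, `Tower_NegExponent`, `Tower_Door`,
`Arch_SharpeningNegExponent`, `Arch_InflationDoor` — cited BY NAME, nothing restated; vocabulary p532994 `RHHeightScaling` (`ExponentAtMost`, `NegExponent`,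
`DoorAt`, `price`, `demand`, `two_mul_sum_price_le_cap`, `demand_nonneg`, `not_doorAt_of_negExponent`). Class inputs of record: rh2-q2-cond
`ROUND4/R4-6-TOWER-rh2-q2-cond.md` 9524c41094a2fe2a (+ p537683), rh2-w-1 `ROUND4/R4-6-ARCH-rh2-w-1.md` 7e7e90cddaf2fad9; abstract faces already landed by this
seat: p537968 `RHHeightScalingR4ArchFace`, p538733 `…R4DegreeFace` (pending at filing), `…R4MultiLFace` (pending).

THE GENERIC FACE (§1): along ANY `PlaceRay`, if the trivial mass grows at least linearly in the step (`n·M₁ ≤ M(n)`, `M₁ > 0`) and the price ceiling is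
height-free (`Π(n) ≤ P`), the netting-envelope kept fraction `min(M,Π)/M` read along the real parameter (`stepProfile`, `n = ⌊s⌋₊ ≥ s/2` for `s ≥ 1`) has
`ExponentAtMost (−1) (2·max(P,0)/M₁)`, hence `Ray_NegExponent` — the D2 «conductor-type credit vs. `T ∝ h`» sentence for rays; dually, a linear price FLOOR
(`n·B ≤ Π(n)`, `B > 0`) with exactly linear mass gives `Ray_Door` with constant `min(1, B/M₁)`. Every class Prop below is this face plus the class's
per-place cap (p532994 `two_mul_sum_price_le_cap` at the class's integers) or floor.
WHAT IS PROVED (namespace `Summit.ABC.IUTFork.Repair.RH.HeightScalingR4.RayFaces`; [folklore] real/integer arithmetic; 0 `sorry`):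
* §1 (private `le_two_mul_natFloor`) · `nettingKept_le_div` · **`ray_exponentAtMost`** · **`ray_negExponent`** · `nettingKept_ge_of_floor` ·
  **`ray_door_of_linear_floor`**; per-place cap/positivity helpers `sum_price_le_cap_real`, `sum_demand_nonneg_real`.
* §2 CLASS (iii) TOWER: `totalPrice_towerRay_le` (height-free cap `Σ_W u_w·(δ_w + 2G_w + e_w − 1)·L(L+1)/2`), **`tower_negExponent : Tower_NegExponent`**,
  **`not_tower_door : ¬ Tower_Door`** ⇒ census O-08: KILLED-BY-CONSISTENCY (kernel face on the typed Prop).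
* §3 CLASS (iv) ARCH: `totalDemand_archRay` (`M(n) = n·M(1)`), `totalPrice_archRay_le` (bounded multipliers ⇒ cap `Σ_W u_w·(δ_w + 2G_w + e_w)·L(L+1)/2`,
  `N` cancels), **`arch_sharpeningNegExponent : Arch_SharpeningNegExponent`** (O-09 sharpening: KILLED-BY-CONSISTENCY on the typed Prop);
  `price_ge_span` (`price ≥ (j+1)·G` when `j·δ ≥ 0`), `totalPrice_archRay_inflation_ge` (`Π(n) ≥ n·κ·L·Σ_W u_w G_w`), **`arch_inflationDoor : Arch_InflationDoor`**
  (O-09b: the Ind2 inflation IS door-shaped in kernel — an inflation, not a sharpening; closing vs `κ_lic` is p537968's dichotomy).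
HONEST FRAMING: real/integer arithmetic about OUR typed rays; the classes, rays and doors are claim-tagged hypotheses of the R4 census (modelling choices
recorded in `RHHeightScalingR4Classes` and the class seats' memos), never Literature facts; KILLED-BY-CONSISTENCY / door-SHAPED are words about OUR profiles,
not about [IUTchIII] Cor. 3.12 / [IUTchIV] Thm. 1.10 in print; nothing here asserts that abc is proved or refuted, or takes a side on any author; typed ≠ proved
(for the objects); a door SHAPE is an untested opening, not a result.
-/

noncomputable section

namespace Summit.ABC.IUTFork.Repair.RH.HeightScalingR4.RayFaces

open Finset
open Summit.ABC.IUTFork.Repair.RH.HeightScaling Summit.ABC.IUTFork.Repair.RH.HeightScalingR4Classes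

variable {ι : Type}

/-! ## §1. The generic ray face -/

/-- `s ≥ 1 ⇒ s ≤ 2·⌊s⌋₊` (the step lags the real parameter by at most a factor `2`; `1 ≤ ⌊s⌋₊` is Mathlib's `Nat.one_le_floor_iff`).
Private helper (a twin lives in another summit's Theorems, not importable here; review p540162). [folklore] -/
private theorem le_two_mul_natFloor {s : ℝ} (hs : 1 ≤ s) : s ≤ 2 * (⌊s⌋₊ : ℝ) := by
  have h1 : (1 : ℝ) ≤ (⌊s⌋₊ : ℝ) := by exact_mod_cast (Nat.one_le_floor_iff s).mpr hs
  have h2 : s < (⌊s⌋₊ : ℝ) + 1 := Nat.lt_floor_add_one s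
  linarith

/-- **Kept fraction under a height-free ceiling**: `n·M₁ ≤ M(n)` (`M₁ > 0`, `n ≥ 1`) and `Π(n) ≤ P` give `min(M,Π)/M ≤ max(P,0)/(n·M₁)`. [folklore] -/
theorem nettingKept_le_div (R : PlaceRay ι) (n : ℕ) {M₁ P : ℝ} (hM₁ : 0 < M₁) (hn : 1 ≤ n)
    (hM : (n : ℝ) * M₁ ≤ totalDemand R n) (hP : totalPrice R n ≤ P) :
    nettingKept R n ≤ max P 0 / ((n : ℝ) * M₁) := by
  have hn' : (0 : ℝ) < (n : ℝ) := by exact_mod_cast lt_of_lt_of_le Nat.zero_lt_one hn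
  have hnM : 0 < (n : ℝ) * M₁ := mul_pos hn' hM₁
  have hMpos : 0 < totalDemand R n := lt_of_lt_of_le hnM hM
  unfold nettingKept
  have h1 : min (totalDemand R n) (totalPrice R n) ≤ max P 0 :=
    (min_le_right _ _).trans (hP.trans (le_max_left _ _))
  calc min (totalDemand R n) (totalPrice R n) / totalDemand R n ≤ max P 0 / totalDemand R n :=
        div_le_div_of_nonneg_right h1 hMpos.le
    _ ≤ max P 0 / ((n : ℝ) * M₁) := div_le_div_of_nonneg_left (le_max_right _ _) hnM hM

/-- **THE GENERIC RAY FACE, quantitative**: linear mass floor + height-free price ceiling ⇒ `ExponentAtMost (stepProfile (nettingKept R)) (−1) (2·max(P,0)/M₁)`.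
[folklore] -/
theorem ray_exponentAtMost (R : PlaceRay ι) {M₁ P : ℝ} (hM₁ : 0 < M₁)
    (hM : ∀ n : ℕ, 1 ≤ n → (n : ℝ) * M₁ ≤ totalDemand R n) (hP : ∀ n : ℕ, 1 ≤ n → totalPrice R n ≤ P) :
    ExponentAtMost (stepProfile (nettingKept R)) (-1) (2 * max P 0 / M₁) := by
  intro s hs
  have hn := (Nat.one_le_floor_iff s).mpr hs
  have h2 := le_two_mul_natFloor hs
  have hs0 : 0 < s := lt_of_lt_of_le zero_lt_one hs
  have hb := nettingKept_le_div R ⌊s⌋₊ hM₁ hn (hM _ hn) (hP _ hn)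
  unfold stepProfile
  rw [Real.rpow_neg_one]
  have hP0 : 0 ≤ max P 0 := le_max_right _ _
  calc nettingKept R ⌊s⌋₊ ≤ max P 0 / ((⌊s⌋₊ : ℝ) * M₁) := hb
    _ ≤ max P 0 / (s / 2 * M₁) :=
        div_le_div_of_nonneg_left hP0 (by positivity) (by nlinarith)
    _ = 2 * max P 0 / M₁ * s⁻¹ := by
        field_simp

/-- **THE GENERIC RAY FACE**: linear mass floor + height-free price ceiling ⇒ `Ray_NegExponent R`. [folklore] -/
theorem ray_negExponent (R : PlaceRay ι) {M₁ P : ℝ} (hM₁ : 0 < M₁)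
    (hM : ∀ n : ℕ, 1 ≤ n → (n : ℝ) * M₁ ≤ totalDemand R n) (hP : ∀ n : ℕ, 1 ≤ n → totalPrice R n ≤ P) :
    Ray_NegExponent R :=
  ⟨-1, 2 * max P 0 / M₁, by norm_num, div_nonneg (mul_nonneg zero_le_two (le_max_right _ _)) hM₁.le,
    ray_exponentAtMost R hM₁ hM hP⟩

/-- **Kept fraction over a linear price floor**: `M(n) = n·M₁` (`M₁ > 0`, `n ≥ 1`) and `n·B ≤ Π(n)` give `min(1, B/M₁) ≤ min(M,Π)/M`. [folklore] -/
theorem nettingKept_ge_of_floor (R : PlaceRay ι) (n : ℕ) {M₁ B : ℝ} (hM₁ : 0 < M₁) (hn : 1 ≤ n)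
    (hM : totalDemand R n = (n : ℝ) * M₁) (hB : (n : ℝ) * B ≤ totalPrice R n) :
    min 1 (B / M₁) ≤ nettingKept R n := by
  have hn' : (0 : ℝ) < (n : ℝ) := by exact_mod_cast lt_of_lt_of_le Nat.zero_lt_one hn
  have hnM : 0 < (n : ℝ) * M₁ := mul_pos hn' hM₁
  unfold nettingKept
  rw [hM, le_div_iff₀ hnM]
  rcases le_total ((n : ℝ) * M₁) (totalPrice R n) with h | h
  · rw [min_eq_left h]
    have : min 1 (B / M₁) ≤ 1 := min_le_left _ _
    nlinarith
  · rw [min_eq_right h]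
    have h1 : min 1 (B / M₁) ≤ B / M₁ := min_le_right _ _
    have h2 : B / M₁ * ((n : ℝ) * M₁) = (n : ℝ) * B := by field_simp
    calc min 1 (B / M₁) * ((n : ℝ) * M₁) ≤ B / M₁ * ((n : ℝ) * M₁) := mul_le_mul_of_nonneg_right h1 hnM.le
      _ = (n : ℝ) * B := h2
      _ ≤ totalPrice R n := hB

/-- **THE GENERIC DOOR SHAPE**: exactly linear mass + a linear price FLOOR with positive slope ⇒ `Ray_Door R` (constant `min(1, B/M₁)`). [folklore] -/
theorem ray_door_of_linear_floor (R : PlaceRay ι) {M₁ B : ℝ} (hM₁ : 0 < M₁) (hB : 0 < B)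
    (hM : ∀ n : ℕ, 1 ≤ n → totalDemand R n = (n : ℝ) * M₁) (hfloor : ∀ n : ℕ, 1 ≤ n → (n : ℝ) * B ≤ totalPrice R n) :
    Ray_Door R := by
  refine ⟨min 1 (B / M₁), lt_min zero_lt_one (div_pos hB hM₁), fun s hs => ?_⟩
  have hn := (Nat.one_le_floor_iff s).mpr hs
  unfold stepProfile
  exact nettingKept_ge_of_floor R ⌊s⌋₊ hM₁ hn (hM _ hn) (hfloor _ hn)

/-- Per place, in reals: `Σ_{j≤L} price_j ≤ (δ + 2(r_in − r_out) + (e − 1))·L(L+1)/2` (p532994 `two_mul_sum_price_le_cap`, cast). [folklore] -/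
theorem sum_price_le_cap_real {e m δ rin rout : ℤ} (he : 0 < e) (hio : rout ≤ rin) (L : ℕ) :
    ((∑ k ∈ range L, price e m (1 + (k : ℤ)) δ rin rout : ℤ) : ℝ) ≤
      (((δ + 2 * (rin - rout) + (e - 1)) * ((L : ℤ) * (L + 1)) : ℤ) : ℝ) / 2 := by
  have h := two_mul_sum_price_le_cap (m := m) (δ := δ) he hio L
  have h' : (2 : ℝ) * ((∑ k ∈ range L, price e m (1 + (k : ℤ)) δ rin rout : ℤ) : ℝ) ≤
      (((δ + 2 * (rin - rout) + (e - 1)) * ((L : ℤ) * (L + 1)) : ℤ) : ℝ) := by exact_mod_cast h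
  linarith

/-- Per place, in reals: the demand total is non-negative at non-negative depth (p532994 `demand_nonneg`). [folklore] -/
theorem sum_demand_nonneg_real {m : ℤ} (hm : 0 ≤ m) (L : ℕ) :
    (0 : ℝ) ≤ ((∑ k ∈ range L, demand m (1 + (k : ℤ)) : ℤ) : ℝ) := by
  have h : (0 : ℤ) ≤ ∑ k ∈ range L, demand m (1 + (k : ℤ)) :=
    sum_nonneg fun k _ => demand_nonneg hm (by have := Int.natCast_nonneg k; omega)
  exact_mod_cast h

/-- Per place: the demand total at depth `t·m₁` is `t` times the one at `m₁` (p532994 `demand_dilate`, summed and cast). [folklore] -/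
theorem sum_demand_dilate_real (t m₁ : ℤ) (L : ℕ) :
    ((∑ k ∈ range L, demand (t * m₁) (1 + (k : ℤ)) : ℤ) : ℝ) = (t : ℝ) * ((∑ k ∈ range L, demand m₁ (1 + (k : ℤ)) : ℤ) : ℝ) := by
  have h : ∑ k ∈ range L, demand (t * m₁) (1 + (k : ℤ)) = t * ∑ k ∈ range L, demand m₁ (1 + (k : ℤ)) := by
    rw [mul_sum]; exact sum_congr rfl fun k _ => demand_dilate t m₁ _
  rw [h]; push_cast; ring

/-! ## §2. CLASS (iii) TOWER: `Tower_NegExponent` and `¬ Tower_Door` -/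

/-- **The tower orbit's price ceiling is height-free**: along `towerRay t …` (any multiplier schedule `t`), over conjugate-fibre places with `0 < e`,
`r_out ≤ r_in`, weights `u ≥ 0`: `Π(n) ≤ Σ_W u_w·(δ_w + 2(r_in−r_out)_w + (e_w−1))·L(L+1)/2` at every step. [folklore] -/
theorem totalPrice_towerRay_le (t : ℕ → ι → ℤ) (W : Finset ι) (L : ℕ) (e m₁ δ rin rout : ι → ℤ) (u : ι → ℝ) (tol : ℝ)
    (he : ∀ w ∈ W, 0 < e w) (hio : ∀ w ∈ W, rout w ≤ rin w) (hu : ∀ w ∈ W, 0 ≤ u w) (n : ℕ) :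
    totalPrice (towerRay t W L e m₁ δ rin rout u tol) n ≤
      ∑ w ∈ W, u w * ((((δ w + 2 * (rin w - rout w) + (e w - 1)) * ((L : ℤ) * (L + 1)) : ℤ) : ℝ) / 2) := by
  unfold totalPrice towerRay
  exact sum_le_sum fun w hw => mul_le_mul_of_nonneg_left (sum_price_le_cap_real (he w hw) (hio w hw) L) (hu w hw)

/-- **`Tower_NegExponent` HOLDS** (census O-08, class (iii): the netting envelope along every isogeny/Kummer-tower orbit of at-least-linear height over
conjugate-fibre places has a negative exponent — the generic ray face with the tower's height-free price ceiling). [folklore] -/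
theorem tower_negExponent : Tower_NegExponent := by
  intro ι t W L e m₁ δ rin rout u tol M₁ _ht he _hδ hio _hm hu hM₁ hM
  exact ray_negExponent _ hM₁ hM (fun n _ => totalPrice_towerRay_le t W L e m₁ δ rin rout u tol he hio hu n)

/-- **`Tower_Door` FAILS** (its negation: (iii-a) + p532994 `not_doorAt_of_negExponent`). KILLED-BY-CONSISTENCY, kernel face. [folklore] -/
theorem not_tower_door : ¬ Tower_Door := by
  rintro ⟨ι, t, W, L, e, m₁, δ, rin, rout, u, tol, M₁, ht, he, hδ, hio, hm, hu, hM₁, hM, hdoor⟩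
  exact not_doorAt_of_negExponent (tower_negExponent ι t W L e m₁ δ rin rout u tol M₁ ht he hδ hio hm hu hM₁ hM) hdoor

/-! ## §3. CLASS (iv) ARCH: `Arch_SharpeningNegExponent` and `Arch_InflationDoor` -/

/-- **Along `archRay` the mass is EXACTLY linear**: `M(n) = n·M(1)` (`demand (N·n·m₁) j = n·demand (N·m₁) j`). [folklore] -/
theorem totalDemand_archRay (N : ℕ) (aD a : ℕ → ℤ) (W : Finset ι) (L : ℕ) (e m₁ δ rin rout : ι → ℤ) (u : ι → ℝ) (tol : ℝ) (n : ℕ) :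
    totalDemand (archRay N aD a W L e m₁ δ rin rout u tol) n = (n : ℝ) * totalDemand (archRay N aD a W L e m₁ δ rin rout u tol) 1 := by
  unfold totalDemand archRay
  simp only [Nat.cast_one, mul_one]
  rw [mul_sum]
  refine sum_congr rfl fun w _ => ?_
  have h1 : (N : ℤ) * (n : ℤ) * m₁ w = (n : ℤ) * ((N : ℤ) * m₁ w) := by ring
  rw [h1, sum_demand_dilate_real]
  push_cast
  ring

/-- **Bounded multipliers keep the price ceiling height-free along `archRay`**: with `0 ≤ aD n ≤ N`, `0 ≤ a n ≤ N`, `δ ≥ 0`, `r_out ≤ r_in`, `0 < e`, `u ≥ 0`,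
`N ≥ 1`: `Π(n) ≤ Σ_W u_w·(δ_w + 2(r_in−r_out)_w + e_w)·L(L+1)/2` at every step (`N` cancels against the weight `u/N`). [folklore] -/
theorem totalPrice_archRay_le (N : ℕ) (aD a : ℕ → ℤ) (W : Finset ι) (L : ℕ) (e m₁ δ rin rout : ι → ℤ) (u : ι → ℝ) (tol : ℝ)
    (hN : 1 ≤ N) (haD : ∀ n, 0 ≤ aD n ∧ aD n ≤ N) (ha : ∀ n, 0 ≤ a n ∧ a n ≤ N) (he : ∀ w ∈ W, 0 < e w) (hδ : ∀ w ∈ W, 0 ≤ δ w)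
    (hio : ∀ w ∈ W, rout w ≤ rin w) (hu : ∀ w ∈ W, 0 ≤ u w) (n : ℕ) :
    totalPrice (archRay N aD a W L e m₁ δ rin rout u tol) n ≤
      ∑ w ∈ W, u w * ((((δ w + 2 * (rin w - rout w) + e w) * ((L : ℤ) * (L + 1)) : ℤ) : ℝ) / 2) := by
  unfold totalPrice archRay
  dsimp only
  refine sum_le_sum fun w hw => ?_
  have hN0 : (0 : ℤ) < N := by exact_mod_cast lt_of_lt_of_le Nat.zero_lt_one hN
  have hNR : (0 : ℝ) < (N : ℝ) := by exact_mod_cast hN0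
  have he' : 0 < (N : ℤ) * e w := mul_pos hN0 (he w hw)
  have hio' : a n * rout w ≤ a n * rin w := mul_le_mul_of_nonneg_left (hio w hw) (ha n).1
  have hcap := sum_price_le_cap_real (m := (N : ℤ) * (n : ℤ) * m₁ w) (δ := aD n * δ w) he' hio' L
  -- the scaled cap is at most `N` times the unscaled one
  have hLL : (0 : ℤ) ≤ (L : ℤ) * (L + 1) := by positivity
  have hint : (aD n * δ w + 2 * (a n * rin w - a n * rout w) + ((N : ℤ) * e w - 1)) * ((L : ℤ) * (L + 1)) ≤
      (N : ℤ) * ((δ w + 2 * (rin w - rout w) + e w) * ((L : ℤ) * (L + 1))) := by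
    have h1 : aD n * δ w ≤ (N : ℤ) * δ w := mul_le_mul_of_nonneg_right (haD n).2 (hδ w hw)
    have h2 : a n * rin w - a n * rout w ≤ (N : ℤ) * (rin w - rout w) := by
      have := mul_le_mul_of_nonneg_right (ha n).2 (sub_nonneg.mpr (hio w hw)); nlinarith
    nlinarith
  have hint' : ((((aD n * δ w + 2 * (a n * rin w - a n * rout w) + ((N : ℤ) * e w - 1)) * ((L : ℤ) * (L + 1))) : ℤ) : ℝ) ≤
      (N : ℝ) * ((((δ w + 2 * (rin w - rout w) + e w) * ((L : ℤ) * (L + 1))) : ℤ) : ℝ) := by exact_mod_cast hint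
  have hu' : 0 ≤ u w / (N : ℝ) := div_nonneg (hu w hw) hNR.le
  calc u w / (N : ℝ) * ((∑ k ∈ range L, price ((N : ℤ) * e w) ((N : ℤ) * (n : ℤ) * m₁ w) (1 + (k : ℤ)) (aD n * δ w)
          (a n * rin w) (a n * rout w) : ℤ) : ℝ)
        ≤ u w / (N : ℝ) * ((N : ℝ) * ((((δ w + 2 * (rin w - rout w) + e w) * ((L : ℤ) * (L + 1))) : ℤ) : ℝ) / 2) :=
          mul_le_mul_of_nonneg_left (hcap.trans (by linarith)) hu'
    _ = u w * ((((δ w + 2 * (rin w - rout w) + e w) * ((L : ℤ) * (L + 1)) : ℤ) : ℝ) / 2) := by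
          field_simp

/-- **`Arch_SharpeningNegExponent` HOLDS** (census O-09, sharpening sub-class: every bounded multiplier law on Ind1/Ind2 keeps a height-free price ceiling
against an exactly linear mass — the generic ray face). KILLED-BY-CONSISTENCY on the typed Prop. [folklore] -/
theorem arch_sharpeningNegExponent : Arch_SharpeningNegExponent := by
  intro ι N aD a W L e m₁ δ rin rout u tol hN haD ha he hδ hio hm hu hM1
  set R := archRay N aD a W L e m₁ δ rin rout u tol with hR
  refine ray_negExponent R hM1 (fun n _ => ?_) fun n _ => totalPrice_archRay_le N aD a W L e m₁ δ rin rout u tol hN haD ha he hδ hio hu n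
  rw [hR, totalDemand_archRay N aD a W L e m₁ δ rin rout u tol n]

/-- Per cell: with `j·δ ≥ 0` and `0 < e` the exact price is at least the log-shell span term `(j+1)·(r_in − r_out)` (residue `≥ 0`). [folklore] -/
theorem price_ge_span {e m j δ rin rout : ℤ} (he : 0 < e) (hjδ : 0 ≤ j * δ) :
    (j + 1) * (rin - rout) ≤ price e m j δ rin rout := by
  unfold price
  have h0 := Int.emod_nonneg (j ^ 2 * m - j * δ - (j + 1) * rin) he.ne'
  linarith

/-- **Along the Ind2 INFLATION ray the price has a LINEAR FLOOR**: with `a n = κ·N·n`, Ind1 bounded below by `0`, `δ ≥ 0`, `r_out ≤ r_in`, `0 < e`, `u ≥ 0`,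
`N ≥ 1`: `Π(n) ≥ n·(κ·L·Σ_W u_w·(r_in − r_out)_w)` at every step. [folklore] -/
theorem totalPrice_archRay_inflation_ge (N κ : ℕ) (aD : ℕ → ℤ) (W : Finset ι) (L : ℕ) (e m₁ δ rin rout : ι → ℤ) (u : ι → ℝ) (tol : ℝ)
    (hN : 1 ≤ N) (haD : ∀ n, 0 ≤ aD n ∧ aD n ≤ N) (he : ∀ w ∈ W, 0 < e w) (hδ : ∀ w ∈ W, 0 ≤ δ w) (hio : ∀ w ∈ W, rout w ≤ rin w)
    (hu : ∀ w ∈ W, 0 ≤ u w) (n : ℕ) :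
    (n : ℝ) * ((κ : ℝ) * (L : ℝ) * ∑ w ∈ W, u w * (((rin w - rout w) : ℤ) : ℝ)) ≤
      totalPrice (archRay N aD (fun n => (κ : ℤ) * N * n) W L e m₁ δ rin rout u tol) n := by
  unfold totalPrice archRay
  dsimp only
  rw [mul_sum, mul_sum]
  refine sum_le_sum fun w hw => ?_
  have hN0 : (0 : ℤ) < N := by exact_mod_cast lt_of_lt_of_le Nat.zero_lt_one hN
  have hNR : (0 : ℝ) < (N : ℝ) := by exact_mod_cast hN0
  have he' : 0 < (N : ℤ) * e w := mul_pos hN0 (he w hw)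
  have hG : 0 ≤ rin w - rout w := sub_nonneg.mpr (hio w hw)
  -- per cell floor: price ≥ (j+1)·κNn·G ≥ κNn·G
  have hcell : ∀ k ∈ range L, (κ : ℤ) * N * n * (rin w - rout w) ≤
      price ((N : ℤ) * e w) ((N : ℤ) * (n : ℤ) * m₁ w) (1 + (k : ℤ)) (aD n * δ w) ((κ : ℤ) * N * n * rin w) ((κ : ℤ) * N * n * rout w) := by
    intro k _
    have hk : (0 : ℤ) ≤ k := Int.natCast_nonneg k
    have hjδ : 0 ≤ (1 + (k : ℤ)) * (aD n * δ w) := mul_nonneg (by omega) (mul_nonneg (haD n).1 (hδ w hw))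
    have hp := price_ge_span (m := (N : ℤ) * (n : ℤ) * m₁ w) (rin := (κ : ℤ) * N * n * rin w) (rout := (κ : ℤ) * N * n * rout w) he' hjδ
    have hκ : (0 : ℤ) ≤ (κ : ℤ) * N * n * (rin w - rout w) := by positivity
    have hexp : (1 + (k : ℤ) + 1) * ((κ : ℤ) * N * n * rin w - (κ : ℤ) * N * n * rout w) =
        (1 + (k : ℤ) + 1) * ((κ : ℤ) * N * n * (rin w - rout w)) := by ring
    rw [hexp] at hp
    nlinarith
  have hsum := sum_le_sum hcell
  rw [sum_const, card_range, nsmul_eq_mul] at hsum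
  have hsum' : (((L : ℤ) * ((κ : ℤ) * N * n * (rin w - rout w)) : ℤ) : ℝ) ≤
      ((∑ k ∈ range L, price ((N : ℤ) * e w) ((N : ℤ) * (n : ℤ) * m₁ w) (1 + (k : ℤ)) (aD n * δ w) ((κ : ℤ) * N * n * rin w)
        ((κ : ℤ) * N * n * rout w) : ℤ) : ℝ) := by
    exact_mod_cast hsum
  have hu' : 0 ≤ u w / (N : ℝ) := div_nonneg (hu w hw) hNR.le
  calc (n : ℝ) * ((κ : ℝ) * (L : ℝ) * (u w * (((rin w - rout w) : ℤ) : ℝ)))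
        = u w / (N : ℝ) * ((((L : ℤ) * ((κ : ℤ) * N * n * (rin w - rout w))) : ℤ) : ℝ) := by
          push_cast; field_simp
    _ ≤ u w / (N : ℝ) * ((∑ k ∈ range L, price ((N : ℤ) * e w) ((N : ℤ) * (n : ℤ) * m₁ w) (1 + (k : ℤ)) (aD n * δ w)
          ((κ : ℤ) * N * n * rin w) ((κ : ℤ) * N * n * rout w) : ℤ) : ℝ) := mul_le_mul_of_nonneg_left hsum' hu'

/-- **`Arch_InflationDoor` HOLDS** (census O-09b: the Ind2 linear inflation `a n = κ·N·n` IS a `Ray_Door` — exactly linear mass, linear price floor with slope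
`κ·L·Σ u·G > 0` from the one weighted place with a positive log-shell span; DOOR-SHAPED because it is an inflation, not a sharpening; its closing dichotomy
vs `κ_lic` is p537968 `archInflation_dichotomy`). [folklore] -/
theorem arch_inflationDoor : Arch_InflationDoor := by
  intro ι N κ aD W L e m₁ δ rin rout u tol hN hκ hL haD he hδ hio hm hu hpos hM1
  set R := archRay N aD (fun n => (κ : ℤ) * N * n) W L e m₁ δ rin rout u tol with hR
  -- the floor slope is positive: one weighted place with a positive span, all others ≥ 0
  obtain ⟨w₀, hw₀, hG₀, hu₀⟩ := hpos
  have hS : 0 < ∑ w ∈ W, u w * (((rin w - rout w) : ℤ) : ℝ) := by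
    have hle : u w₀ * (((rin w₀ - rout w₀) : ℤ) : ℝ) ≤ ∑ w ∈ W, u w * (((rin w - rout w) : ℤ) : ℝ) :=
      single_le_sum (f := fun w => u w * (((rin w - rout w) : ℤ) : ℝ))
        (fun w hw => mul_nonneg (hu w hw) (by exact_mod_cast sub_nonneg.mpr (hio w hw))) hw₀
    have hG₀' : (0 : ℝ) < (((rin w₀ - rout w₀) : ℤ) : ℝ) := by exact_mod_cast sub_pos.mpr hG₀
    exact lt_of_lt_of_le (mul_pos hu₀ hG₀') hle
  have hB : 0 < (κ : ℝ) * (L : ℝ) * ∑ w ∈ W, u w * (((rin w - rout w) : ℤ) : ℝ) := by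
    have hκR : (0 : ℝ) < κ := by exact_mod_cast lt_of_lt_of_le Nat.zero_lt_one hκ
    have hLR : (0 : ℝ) < L := by exact_mod_cast lt_of_lt_of_le (by norm_num) hL
    positivity
  refine ray_door_of_linear_floor R hM1 hB (fun n _ => ?_) fun n _ => ?_
  · rw [hR, totalDemand_archRay]
  · rw [hR]
    exact totalPrice_archRay_inflation_ge N κ aD W L e m₁ δ rin rout u tol hN haD he hδ hio hu n

end Summit.ABC.IUTFork.Repair.RH.HeightScalingR4.RayFaces

end
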